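import Literature.MathematicalPhysics.KineticTheory.HardSphereBBGKYLiouvilleFlow
import Literature.MathematicalPhysics.KineticTheory.HardSphereEuler
import HarnessLib

/-!
# Crux `NearConstantShortTimeHL` (stmt-AtomisticToContinuum-12502), line `small-tilt-domination` — tools of the Gronwall assembly

Lead c2, helpers of `stub_gronwallAssembly` (NOTES § S5b architecture):

* `discrete_gronwall` — the discrete Gronwall lemma on a grid: `a_k ≤ A + B ∑_{j<k} a_j` for all `k` (with `A, B ≥ 0`) gives
  `a_k ≤ A (1 + B)^k` (step (6) of the assembly, with `B = C m / γ` and `k ≤ t/m`, `(1 + Cm/γ)^{t/m} ≤ e^{Ct/γ}`);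
* `measurable_setIntegral_piecewise_flow`, `aemeasurable_setIntegral_flow` — time integrals of jointly measurable observables along the
  hard-sphere flow are measurable functions of the initial datum (on the good set, resp. almost everywhere for laws `≪` Liouville) — the
  measurability half of "expected weak balance laws" (step (3)), from the joint measurability of the flow on `ℝ × good`
  (`HardSphereFlow.measurable_piecewise_flow`, `measurable_piecewise_flow_torus`).
-/

noncomputable section

namespace Summit.AtomisticToContinuum.HydrodynamicLimit.Theorems.NearConstantShortTimeHL

open scoped BigOperators ENNReal
open MeasureTheory Set Filter
open Literature.MathematicalPhysics.KineticTheory Literature.Analysis.FluidPDE Literature.Analysis.FunctionSpaces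

/-! ## The discrete Gronwall lemma -/

/-- **Discrete Gronwall.** If a real sequence satisfies `a_k ≤ A + B ∑_{j<k} a_j` for every `k`, with `A, B ≥ 0`, then
`a_k ≤ A (1 + B)^k` for every `k` (strong induction; `B ∑_{j<k} (1+B)^j = (1+B)^k − 1`). [folklore] -/
theorem discrete_gronwall : ∀ {a : ℕ → ℝ} {A B : ℝ}, 0 ≤ A → 0 ≤ B →
    (∀ k, a k ≤ A + B * ∑ j ∈ Finset.range k, a j) → ∀ k, a k ≤ A * (1 + B) ^ k := by
  intro a A B hA hB h k
  induction k using Nat.strong_induction_on with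
  | _ k ih =>
    have hsum : ∑ j ∈ Finset.range k, a j ≤ ∑ j ∈ Finset.range k, A * (1 + B) ^ j :=
      Finset.sum_le_sum fun j hj => ih j (Finset.mem_range.1 hj)
    have hgeom : B * ∑ j ∈ Finset.range k, A * (1 + B) ^ j = A * ((1 + B) ^ k - 1) := by
      rw [← Finset.mul_sum]
      have := geom_sum_mul (1 + B) k
      rw [add_sub_cancel_left] at this
      calc B * (A * ∑ j ∈ Finset.range k, (1 + B) ^ j)
          = A * ((∑ j ∈ Finset.range k, (1 + B) ^ j) * B) := by ring
        _ = A * ((1 + B) ^ k - 1) := by rw [this]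
    calc a k ≤ A + B * ∑ j ∈ Finset.range k, a j := h k
      _ ≤ A + B * ∑ j ∈ Finset.range k, A * (1 + B) ^ j := by gcongr
      _ = A * (1 + B) ^ k := by rw [hgeom]; ring

/-- The exponential form of the discrete Gronwall bound: `A (1 + B)^k ≤ A e^{B k}`. [folklore] -/
theorem discrete_gronwall_exp {a : ℕ → ℝ} {A B : ℝ} (hA : 0 ≤ A) (hB : 0 ≤ B)
    (h : ∀ k, a k ≤ A + B * ∑ j ∈ Finset.range k, a j) (k : ℕ) : a k ≤ A * Real.exp (B * k) := by
  refine (discrete_gronwall hA hB h k).trans (mul_le_mul_of_nonneg_left ?_ hA)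
  have h1 : 1 + B ≤ Real.exp B := by linarith [Real.add_one_le_exp B]
  calc (1 + B) ^ k ≤ (Real.exp B) ^ k := pow_le_pow_left₀ (by linarith) h1 k
    _ = Real.exp (B * k) := by rw [← Real.exp_nat_mul]; ring_nf

/-! ## Measurability of time integrals along the flow -/

section Flow

variable {ε : ℝ} {n : ℕ}

open scoped Classical in
/-- **Time integrals along the hard-sphere flow are measurable in the initial datum** (flow made constant off the good set): for a
jointly measurable real observable `Y (s, z)` and a time window `(a, b]`, `z ↦ ∫_{(a,b]} Y(s, Φ̃_s z) ds` is measurable, where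
`Φ̃_s = good.piecewise Φ_s id` (`HardSphereFlow.measurable_piecewise_flow`; Bochner integral of a jointly measurable integrand in the
parameter, `StronglyMeasurable.integral_prod_right'`). [folklore] -/
theorem measurable_setIntegral_piecewise_flow (Φ : HardSphereFlow (Torus.geometry (Fin 3)) ε n)
    {Y : ℝ × Config n (Fin 3) T3 → ℝ} (hY : Measurable Y) (a b : ℝ) :
    Measurable fun z => ∫ s in Set.Ioc a b, Y (s, Φ.good.piecewise (Φ.flow s) id z) := by
  have hj : Measurable fun p : Config n (Fin 3) T3 × ℝ => Y (p.2, Φ.good.piecewise (Φ.flow p.2) id p.1) := by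
    refine hY.comp (measurable_snd.prodMk ?_)
    exact Φ.measurable_piecewise_flow_comp (fun x => continuous_const.add Torus.continuous_proj) measurable_snd
      measurable_fst
  exact (hj.stronglyMeasurable.integral_prod_right' (ν := volume.restrict (Set.Ioc a b))).measurable

open scoped Classical in
/-- On the good set the modified flow is the flow, so the time integral along the flow agrees with the measurable one. [folklore] -/
theorem setIntegral_flow_eq_of_mem_good (Φ : HardSphereFlow (Torus.geometry (Fin 3)) ε n)
    (Y : ℝ × Config n (Fin 3) T3 → ℝ) (a b : ℝ) {z : Config n (Fin 3) T3} (hz : z ∈ Φ.good) :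
    (∫ s in Set.Ioc a b, Y (s, Φ.flow s z)) = ∫ s in Set.Ioc a b, Y (s, Φ.good.piecewise (Φ.flow s) id z) := by
  refine setIntegral_congr_fun measurableSet_Ioc fun s _ => ?_
  simp only [Set.piecewise_eq_of_mem _ _ _ hz]

open scoped Classical in
/-- **Time integrals along the flow are a.e.-measurable under every law `≪` Liouville** (good points are Liouville-a.e.). [folklore] -/
theorem aemeasurable_setIntegral_flow (Φ : HardSphereFlow (Torus.geometry (Fin 3)) ε n)
    {Y : ℝ × Config n (Fin 3) T3 → ℝ} (hY : Measurable Y) (a b : ℝ)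
    {μ : Measure (Config n (Fin 3) T3)} (hμ : μ ≪ liouville (Torus.geometry (Fin 3)) n ε) :
    AEMeasurable (fun z => ∫ s in Set.Ioc a b, Y (s, Φ.flow s z)) μ := by
  refine ⟨_, measurable_setIntegral_piecewise_flow Φ hY a b, ?_⟩
  filter_upwards [hμ.ae_le Φ.ae_mem_good] with z hz
  exact setIntegral_flow_eq_of_mem_good Φ Y a b hz

end Flow

end Summit.AtomisticToContinuum.HydrodynamicLimit.Theorems.NearConstantShortTimeHL

end
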